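import Summits.ABC.IUTFork.Cor312ProvenanceDHWitness
import Summits.ABC.IUTFork.Cor312ProvenanceGenuine
import Summits.ABC.IUTFork.Cor312PlacesBadCount
import Summits.ABC.IUTFork.Thm311Real
import Literature.IUT.HodgeTheaters.InitialThetaDataPlaces
import Mathlib.SetTheory.Cardinal.Arithmetic
import Mathlib.Logic.Denumerable
import Mathlib.Data.Nat.PrimeFin
import Mathlib.SetTheory.Cardinal.NatCard
import Mathlib.Data.Set.Card
import HarnessLib

/-!
# [IUTchIII] Cor. 3.12 provenance — the index bookkeeping `hplaces` (`𝕍(F) ≃ V̲`, bad ↔ bad) CHARACTERISED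

PROOF-ONLY record file (no definitions, no `sorry`) of the abc-iut cell (seat abc-iut-w4-d054 gen 5, home L5 [IUTchI]);
TAKES NO SIDE. It settles the READ binder `hplaces : ∃ e : (thetaIndex X).V ≃ D.V, ∀ v, v ∈ (thetaIndex X).Vbad ↔
((e v : D.V) : Val K) ∈ D.Vbad` of the branch-C certificates at the genuine setting (`Conditional.cor312Of_of_SH_genuine`,
`_of_S_genuine`, the `H`-bundle of `abc_of_S_v3`, abc-iut-C-cert-2) = abc-iut-c312-8's field `IsSettingOf.places` at
abc-iut-c312-5's index `thetaIndex X` of Dupuy–Hilado pilot data, kept as the ONE explicit binder by abc-iut-c312-7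
(`Cor312PilotIdelesPrProvenance`, whose docstring states the criterion proved here). Index sets: `(thetaIndex X).V =
Place F = 𝕍(F)` (ALL places of `F`, [IUTchI] §0) with `V^bad = S` ([cite: DupuyHilado2025, §3.3]); [IUTchI] Def. 3.1 (e)'s
section `V̲ ⊆ 𝕍(K)`, `V̲ ⥲ V_mod` (abc-iut-L5-t2's `InitialThetaData.V`), `V̲^bad` = members over `V^bad_mod` (kurims p. 61–62).
RESULTS (all PROVED; classical set theory + the typed definitions; nothing of the series is asserted):
* `exists_equiv_mem_iff_iff`: between COUNTABLY INFINITE types a bijection carrying a FINITE subset `s` exactly onto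
  `{q}` exists iff `s ≃ {q}` (Mathlib `Cardinal.extend_function_of_lt`); `countable_place`/`infinite_place`/`countable_val`:
  place types of a number field are countably infinite (abc-iut-c312-5's `Place.fibre_finite/_nonempty`);
* **`places_iff_nonempty_badEquiv`**: for ANY index skeleton `T` with countably infinite `T.V` and any initial Θ-data:
  `(∃ e : T.V ≃ V̲, bad ↔ bad) ↔ Nonempty (T.Vbad ≃ V̲^bad)`; at `thetaIndex X`: `exists_placesEquiv_iff_nonempty_badEquiv`;
* **`exists_placesEquiv_iff_injOn`**: under abc-iut-c312-8's link `IsPilotDataOf D X` (`S = 𝕍(F)^bad`), `hplaces` ↔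
  restriction `𝕍(F) → V_mod` is INJECTIVE on `𝕍(F)^bad` (no place of `V^bad_mod` has two places of `F` above it; the
  restriction is onto, so equivalently `|𝕍(F)^bad| = |V^bad_mod|`, `exists_placesEquiv_iff_ncard_VFbad_eq`; without
  the link: `hplaces ↔ |S| = |V̲^bad|`, `exists_placesEquiv_iff_card_S_eq`);
  DISCHARGE form `exists_placesEquiv_of_injOn` (+ `…_pilotDataOfF_…`); NEGATIVE companion
  `not_exists_placesEquiv_of_two_over` (a bad place of `F_mod` split in `F` ⇒ `hplaces` fails for every `X` OF `D`);
* `cor312Of_of_statement_of_negLogQ_eq`: the derivation `Statement ⟹ I.Cor312Of` uses the provenance structure only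
  through the `q`-number identity, so a certificate line need not carry `hplaces` (cf. abc-iut-s2-p11's `…_places`
  variants p432598, which delete the binder; the surjective tie `𝕍(F) ↠ V̲` is abc-iut-s2-p11's (P1)).
COUNTS are consumed BY NAME from abc-iut-w6-d105's `Cor312PlacesBadCount` (p432526): `finBelow_image_VFbad`,
`IsPilotDataOf.card_S_eq_ncard_Vbad_iff_injOn`, `ncard_VbadMod_eq_ncard_VFbad_iff_injOn`.
HONEST FRAMING: bookkeeping about OUR typed index sets; locates exactly when the READ binder is satisfiable; nothing
here bears on the truth of [IUTchIII] Cor. 3.12 or on abc; no side taken on any author; every statement is a theorem.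
-/

noncomputable section

namespace Summit.ABC.IUTFork.Cor312Prov

open Literature.IUT.HodgeTheaters Literature.IUT.LogVolume NumberField IsDedekindDomain Thm311 Thm311.Real

universe u v w

/-! ## 1. Set theory: a bijection of countably infinite types matching a finite subset -/

/-- **Matching a finite subset under a bijection of countably infinite types.** For countably infinite `α`, `β`,
a finite `s ⊆ α` and a predicate `q` on `β`: a bijection `e : α ≃ β` with `a ∈ s ↔ q (e a)` exists iff `s ≃ {b // q b}`
(⇒ restrict; ⇐ extend the embedding `s ≃ {q} ↪ β` by Mathlib `Cardinal.extend_function_of_lt`, `#s < ℵ₀ ≤ #α`;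
points outside `s` cannot land in `{q}`, which is exhausted by `s`). [folklore] -/
theorem exists_equiv_mem_iff_iff {α : Type u} {β : Type v} [Countable α] [Infinite α] [Countable β] [Infinite β]
    {s : Set α} (hs : s.Finite) (q : β → Prop) :
    (∃ e : α ≃ β, ∀ a, a ∈ s ↔ q (e a)) ↔ Nonempty (s ≃ {b // q b}) := by
  constructor
  · rintro ⟨e, he⟩
    exact ⟨e.subtypeEquiv he⟩
  · rintro ⟨f⟩
    have hlt : Cardinal.mk s < Cardinal.mk α := hs.lt_aleph0.trans_le (Cardinal.aleph0_le_mk α)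
    obtain ⟨g, hg⟩ := Cardinal.extend_function_of_lt
      (f.toEmbedding.trans (Function.Embedding.subtype q)) hlt inferInstance
    refine ⟨g, fun a => ⟨fun ha => ?_, fun ha => ?_⟩⟩
    · have h1 : g a = ((f ⟨a, ha⟩ : {b // q b}) : β) := hg ⟨a, ha⟩
      rw [h1]
      exact (f ⟨a, ha⟩).2
    · have h1 : g ((f.symm ⟨g a, ha⟩ : s) : α) = g a := by
        rw [hg]
        simp
      have h2 : ((f.symm ⟨g a, ha⟩ : s) : α) = a := g.injective h1
      rw [← h2]
      exact (f.symm ⟨g a, ha⟩).2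

/-- A type fibred over a countable type with finite fibres is countable. [folklore] -/
theorem countable_of_fibre_finite {V : Type u} {VQ : Type v} [Countable VQ] (pr : V → VQ)
    (h : ∀ q, Set.Finite {v | pr v = q}) : Countable V := by
  haveI : ∀ q, Countable {v // pr v = q} := fun q => (h q).countable.to_subtype
  exact Countable.of_equiv _ (Equiv.sigmaFiberEquiv pr)

/-! ## 2. The place types of a number field are countably infinite -/

section PlaceTypes

variable (L : Type) [Field L] [NumberField L]

/-- `𝕍(L)` (all places of a number field, abc-iut-c312-5's `Thm311.Real.Place`) is COUNTABLE: it is fibred over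
`𝕍(ℚ) = {∞} ⊔ Primes` (countable) with finite fibres (`Place.fibre_finite`). [folklore] -/
theorem countable_place : Countable (Thm311.Real.Place L) :=
  countable_of_fibre_finite (VQ := RatPlace) Place.under Place.fibre_finite

/-- `𝕍(L)` is INFINITE: every place of `ℚ` has a place of `L` above it (`Place.fibre_nonempty`) and there are
infinitely many primes. [folklore] -/
theorem infinite_place : Infinite (Thm311.Real.Place L) :=
  Infinite.of_surjective Place.under Place.fibre_nonempty

/-- The nonzero primes of `𝓞 L` form a countable type (they embed in `𝕍(L)`). [folklore] -/
theorem countable_heightOneSpectrum : Countable (HeightOneSpectrum (𝓞 L)) :=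
  haveI : Countable (InfinitePlace L ⊕ HeightOneSpectrum (𝓞 L)) := countable_place L
  (Sum.inr_injective (α := InfinitePlace L) (β := HeightOneSpectrum (𝓞 L))).countable

/-- Mathlib's finite places of `L` form a countable type (`FinitePlace L ≃ HeightOneSpectrum (𝓞 L)`). [folklore] -/
theorem countable_finitePlace : Countable (FinitePlace L) :=
  haveI := countable_heightOneSpectrum L
  Countable.of_equiv _ (FinitePlace.equivHeightOneSpectrum (K := L)).symm

/-- [IUTchI] §0's `V(L) = V(L)^arc ∪ V(L)^non` (abc-iut-L5-t1's `Val L`) is a countable type. [folklore] -/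
theorem countable_val : Countable (Val L) := by
  haveI := countable_finitePlace L
  show Countable (InfinitePlace L ⊕ FinitePlace L)
  infer_instance

end PlaceTypes

/-! ## 3. The characterisation of `hplaces` -/

section Places

variable {F : Type} {K : Type v} {Fbar : Type w} [Field F] [NumberField F] [Field K] [NumberField K]
  [Algebra F K] [Field Fbar] [Algebra F Fbar] [Algebra K Fbar] {E : WeierstrassCurve F} [E.IsElliptic]
  {l : ℕ} {Pb : BadPlacePredicates K}

/-- `V̲` is a COUNTABLE type: it is in bijection with `V_mod = 𝕍(F_mod)` ([IUTchI] Def. 3.1 (e), abc-iut-L5-t2's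
`InitialThetaData.vEquiv`). [claim: Mochizuki2012, status: disputed] -/
theorem countable_coe_V (D : InitialThetaData F K Fbar E l Pb) : Countable ↥D.V :=
  haveI := countable_val (fieldOfModuli E)
  Countable.of_equiv _ D.vEquiv.symm

/-- `V̲^bad` as a subtype of `V̲` is `V̲^bad` (it is contained in `V̲`). [claim: Mochizuki2012, status: disputed] -/
theorem nonempty_equiv_coe_Vbad (D : InitialThetaData F K Fbar E l Pb) :
    Nonempty ({y : ↥D.V // (y : Val K) ∈ D.Vbad} ≃ ↥D.Vbad) :=
  ⟨Equiv.subtypeSubtypeEquivSubtype (p := (· ∈ D.V)) (q := (· ∈ D.Vbad)) fun hx => hx.1⟩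

/-- **The index bookkeeping CHARACTERISED, for any index skeleton.** For an index skeleton `T` ([IUTchIII] Thm. 3.11
index data, abc-iut-c312-1's `Thm311.ThetaIndex`) whose set of places `T.V` is countably infinite, and ANY initial
Θ-data `D` ([IUTchI] Def. 3.1): a bijection `T.V ≃ V̲` matching `T.Vbad` with `V̲^bad` — the field
`IsSettingOf.places` — exists iff `T.Vbad ≃ V̲^bad` (both index sets of places are countably infinite, `T.Vbad` is
finite). [claim: Mochizuki2012, status: disputed] -/
theorem places_iff_nonempty_badEquiv {T : ThetaIndex} [Countable T.V] [Infinite T.V]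
    (D : InitialThetaData F K Fbar E l Pb) :
    (∃ e : T.V ≃ ↥D.V, ∀ v : T.V, v ∈ T.Vbad ↔ ((e v : ↥D.V) : Val K) ∈ D.Vbad) ↔
      Nonempty (↥T.Vbad ≃ ↥D.Vbad) := by
  haveI := countable_coe_V D
  haveI := D.infinite_coe_V
  obtain ⟨i⟩ := nonempty_equiv_coe_Vbad D
  refine (exists_equiv_mem_iff_iff (β := ↥D.V) T.Vbad_finite (fun y : ↥D.V => (y : Val K) ∈ D.Vbad)).trans ?_
  exact ⟨fun ⟨f⟩ => ⟨f.trans i⟩, fun ⟨f⟩ => ⟨f.trans i.symm⟩⟩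

variable (D : InitialThetaData F K Fbar E l Pb) (X : PilotData F)

/-- `𝕍(F)` — the place index of abc-iut-c312-5's `thetaIndex X` — is countable. [folklore] -/
theorem countable_thetaIndex_V : Countable (thetaIndex X).V := countable_place F

/-- `𝕍(F)` — the place index of `thetaIndex X` — is infinite. [folklore] -/
theorem infinite_thetaIndex_V : Infinite (thetaIndex X).V := infinite_place F

/-- `V^bad = S` as types: the bad places of `thetaIndex X` are the chosen finite places `S` of the pilot data,
transported along `Sum.inr`. [cite: DupuyHilado2025, §3.3] -/
theorem nonempty_thetaIndex_Vbad_equiv_S :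
    Nonempty (↥(thetaIndex X).Vbad ≃ ↥(X.S : Set (HeightOneSpectrum (𝓞 F)))) :=
  ⟨(Equiv.Set.image Sum.inr (X.S : Set (HeightOneSpectrum (𝓞 F))) Sum.inr_injective).symm⟩

/-- **`hplaces` CHARACTERISED at the Dupuy–Hilado index**: for pilot data `X` over `F` and initial Θ-data `D`,
`(∃ e : 𝕍(F) ≃ V̲, bad ↔ bad) ↔ Nonempty (V^bad(X) ≃ V̲^bad)` — equivalently `|S| = |V^bad_mod|`. No provenance
hypothesis is needed for this form. [claim: Mochizuki2012, status: disputed] -/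
theorem exists_placesEquiv_iff_nonempty_badEquiv :
    (∃ e : (thetaIndex X).V ≃ ↥D.V, ∀ v : (thetaIndex X).V,
        v ∈ (thetaIndex X).Vbad ↔ ((e v : ↥D.V) : Val K) ∈ D.Vbad) ↔
      Nonempty (↥(thetaIndex X).Vbad ≃ ↥D.Vbad) :=
  haveI := countable_thetaIndex_V X
  haveI := infinite_thetaIndex_V X
  places_iff_nonempty_badEquiv D

/-- The characterisation in COUNTING form: `hplaces ↔ |V^bad(X)| = |V̲^bad|` (both bad sets are finite).
[claim: Mochizuki2012, status: disputed] -/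
theorem exists_placesEquiv_iff_ncard_eq :
    (∃ e : (thetaIndex X).V ≃ ↥D.V, ∀ v : (thetaIndex X).V,
        v ∈ (thetaIndex X).Vbad ↔ ((e v : ↥D.V) : Val K) ∈ D.Vbad) ↔
      (thetaIndex X).Vbad.ncard = D.Vbad.ncard := by
  rw [exists_placesEquiv_iff_nonempty_badEquiv]
  haveI := (thetaIndex X).Vbad_finite.to_subtype
  haveI := D.Vbad_finite.to_subtype
  rw [← Finite.card_eq, Nat.card_coe_set_eq, Nat.card_coe_set_eq]

/-- `|V^bad(X)| = |S|`: the bad places of `thetaIndex X` are `S` transported along `Sum.inr`.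
[cite: DupuyHilado2025, §3.3] -/
theorem ncard_thetaIndex_Vbad : (thetaIndex X).Vbad.ncard = X.S.card := by
  show (Sum.inr '' (X.S : Set (HeightOneSpectrum (𝓞 F))) : Set (Thm311.Real.Place F)).ncard = X.S.card
  rw [Set.ncard_image_of_injective _ Sum.inr_injective, Set.ncard_coe_finset]

/-- `hplaces ↔ |S| = |V̲^bad|` — the numeric hypothesis `h` of the count files (abc-iut-w6-d105's
`Cor312PlacesBadCount`, abc-iut-w4-d020's staged index-bijection file) IS equivalent to the binder; no provenance
hypothesis needed. [claim: Mochizuki2012, status: disputed] -/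
theorem exists_placesEquiv_iff_card_S_eq :
    (∃ e : (thetaIndex X).V ≃ ↥D.V, ∀ v : (thetaIndex X).V,
        v ∈ (thetaIndex X).Vbad ↔ ((e v : ↥D.V) : Val K) ∈ D.Vbad) ↔
      X.S.card = D.Vbad.ncard := by
  rw [exists_placesEquiv_iff_ncard_eq, ncard_thetaIndex_Vbad]

/-! ### Under the provenance link `IsPilotDataOf D X` (`S = 𝕍(F)^bad`) -/

variable {D X}

/-- Injectivity of restriction on `𝕍(F)^bad` in the `Val` vocabulary of [IUTchI] §0 / Def. 3.1 (e) is injectivity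
of abc-iut-L5-t2's place-below map `finBelow` (restriction of a nonarchimedean valuation is `Val.non ∘ finBelow`,
abc-iut-w6-d105's `restrict_non_eq_non_finBelow`). [claim: Mochizuki2012, status: disputed] -/
theorem injOn_restrict_iff_injOn_finBelow (D : InitialThetaData F K Fbar E l Pb) :
    Set.InjOn (fun x : FinitePlace F => Val.restrict (fieldOfModuli E) (Val.non x)) D.VFbad ↔
      Set.InjOn (InitialThetaData.finBelow (E := E)) D.VFbad := by
  constructor
  · intro h x hx y hy hxy
    exact h hx hy (by
      change Val.non (InitialThetaData.finBelow (E := E) x) = Val.non (InitialThetaData.finBelow (E := E) y)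
      rw [hxy])
  · intro h x hx y hy hxy
    exact h hx hy (Sum.inr_injective hxy)

/-- **`hplaces` CHARACTERISED under the provenance link (the theorem behind abc-iut-c312-7's docstring and
abc-iut-C-cert-2's HYPS entry).** For initial Θ-data `D` and Dupuy–Hilado pilot data `X` OF `D`
(`IsPilotDataOf D X`, so `S = 𝕍(F)^bad`): the READ binder
`∃ e : 𝕍(F) ≃ V̲, ∀ v, v ∈ V^bad ↔ e v ∈ V̲^bad` of `Conditional.cor312Of_of_SH_genuine` HOLDS IFF restriction of
valuations `𝕍(F) → 𝕍(F_mod)` is injective on `𝕍(F)^bad` — i.e. iff no place of `V^bad_mod` has two places of `F`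
above it («no bad place of `F_mod` splits in `F`»). Composition of `exists_placesEquiv_iff_card_S_eq` with
abc-iut-w6-d105's count `IsPilotDataOf.card_S_eq_ncard_Vbad_iff_injOn` (consumed BY NAME). [claim: Mochizuki2012, status: disputed] -/
theorem exists_placesEquiv_iff_injOn (hX : IsPilotDataOf D X) :
    (∃ e : (thetaIndex X).V ≃ ↥D.V, ∀ v : (thetaIndex X).V,
        v ∈ (thetaIndex X).Vbad ↔ ((e v : ↥D.V) : Val K) ∈ D.Vbad) ↔
      Set.InjOn (fun x : FinitePlace F => Val.restrict (fieldOfModuli E) (Val.non x)) D.VFbad := by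
  rw [exists_placesEquiv_iff_card_S_eq, hX.card_S_eq_ncard_Vbad_iff_injOn, injOn_restrict_iff_injOn_finBelow]

/-- The same on `D` alone in counting form: `hplaces ↔ |𝕍(F)^bad| = |V^bad_mod|` (abc-iut-w6-d105's
`ncard_VbadMod_eq_ncard_VFbad_iff_injOn` BY NAME). [claim: Mochizuki2012, status: disputed] -/
theorem exists_placesEquiv_iff_ncard_VFbad_eq (hX : IsPilotDataOf D X) :
    (∃ e : (thetaIndex X).V ≃ ↥D.V, ∀ v : (thetaIndex X).V,
        v ∈ (thetaIndex X).Vbad ↔ ((e v : ↥D.V) : Val K) ∈ D.Vbad) ↔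
      D.VFbad.ncard = D.VbadMod.ncard := by
  rw [exists_placesEquiv_iff_card_S_eq, hX.card_S_eq_ncard_Vbad_iff_injOn, eq_comm,
    D.ncard_VbadMod_eq_ncard_VFbad_iff_injOn]

/-- **DISCHARGE FORM of `hplaces`.** If no two places of `𝕍(F)^bad` restrict to the same place of `F_mod`, the index
bijection `𝕍(F) ≃ V̲` matching bad places exists, for every pilot datum `X` OF `D` — the READ binder replaced by an
arithmetic side condition on the datum alone. [claim: Mochizuki2012, status: disputed] -/
theorem exists_placesEquiv_of_injOn (hX : IsPilotDataOf D X)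
    (hinj : Set.InjOn (fun x : FinitePlace F => Val.restrict (fieldOfModuli E) (Val.non x)) D.VFbad) :
    ∃ e : (thetaIndex X).V ≃ ↥D.V, ∀ v : (thetaIndex X).V,
      v ∈ (thetaIndex X).Vbad ↔ ((e v : ↥D.V) : Val K) ∈ D.Vbad :=
  (exists_placesEquiv_iff_injOn hX).mpr hinj

/-- **NEGATIVE COMPANION (honesty of the binder).** If two DISTINCT places of `𝕍(F)^bad` lie over the same place of
`F_mod` (a bad place of `F_mod` that splits in `F`), then `hplaces` FAILS for every pilot datum `X` OF `D`: the READ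
binder of the genuine-setting certificates v3/v4 is then unsatisfiable at `D` (abc-iut-s2-p11's `…_places` variants
drop it; the index-faithful route is abc-iut-c312-5's `thetaIndexOfInitial D`). [claim: Mochizuki2012, status: disputed] -/
theorem not_exists_placesEquiv_of_two_over (hX : IsPilotDataOf D X) {x y : FinitePlace F} (hx : x ∈ D.VFbad)
    (hy : y ∈ D.VFbad) (hne : x ≠ y)
    (hover : Val.restrict (fieldOfModuli E) (Val.non x) = Val.restrict (fieldOfModuli E) (Val.non y)) :
    ¬ ∃ e : (thetaIndex X).V ≃ ↥D.V, ∀ v : (thetaIndex X).V,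
      v ∈ (thetaIndex X).Vbad ↔ ((e v : ↥D.V) : Val K) ∈ D.Vbad := by
  rw [exists_placesEquiv_iff_injOn hX]
  exact fun h => hne (h hx hy hover)

/-! ### At abc-iut-c312-8's own pilot datum `pilotDataOfF D` -/

/-- `hplaces` at `X := pilotDataOfF D` (c312-8's Dupuy–Hilado datum OF `D`) ↔ restriction is injective on `𝕍(F)^bad`.
[claim: Mochizuki2012, status: disputed] -/
theorem exists_placesEquiv_pilotDataOfF_iff_injOn (D : InitialThetaData F K Fbar E l Pb) :
    (∃ e : (thetaIndex (pilotDataOfF D)).V ≃ ↥D.V, ∀ v : (thetaIndex (pilotDataOfF D)).V,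
        v ∈ (thetaIndex (pilotDataOfF D)).Vbad ↔ ((e v : ↥D.V) : Val K) ∈ D.Vbad) ↔
      Set.InjOn (fun x : FinitePlace F => Val.restrict (fieldOfModuli E) (Val.non x)) D.VFbad :=
  exists_placesEquiv_iff_injOn (isPilotDataOf_pilotDataOfF D)

/-- DISCHARGE FORM at `X := pilotDataOfF D`. [claim: Mochizuki2012, status: disputed] -/
theorem exists_placesEquiv_pilotDataOfF_of_injOn (D : InitialThetaData F K Fbar E l Pb)
    (hinj : Set.InjOn (fun x : FinitePlace F => Val.restrict (fieldOfModuli E) (Val.non x)) D.VFbad) :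
    ∃ e : (thetaIndex (pilotDataOfF D)).V ≃ ↥D.V, ∀ v : (thetaIndex (pilotDataOfF D)).V,
      v ∈ (thetaIndex (pilotDataOfF D)).Vbad ↔ ((e v : ↥D.V) : Val K) ∈ D.Vbad :=
  exists_placesEquiv_of_injOn (isPilotDataOf_pilotDataOfF D) hinj

end Places

/-! ## 4. What the certificates USE of the provenance tie: only the `q`-number identity -/

section QIdentity

variable {F K Fbar : Type} [Field F] [NumberField F] [Field K] [NumberField K]
  [Algebra F K] [Field Fbar] [Algebra F Fbar] [Algebra K Fbar] {E : WeierstrassCurve F} [E.IsElliptic]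
  {l : ℕ} {Pb : BadPlacePredicates K}

/-- **`I.Cor312Of` from the printed Statement, the one-sided Θ-identification and the `q`-NUMBER identity ALONE.**
abc-iut-c312-8's `cor312Of_of_statement_of_links` consumes the provenance structure `IsSettingOf D P` only through its
field `negLogQ_eq : P.negLogQ = −absLogq D`; the index fields `lstar_eq`, `places` (= `hplaces`), `VFbad_finite` are NOT
used in the derivation. This variant takes that one identity as the hypothesis, so a certificate line need not carry
`hplaces` at all (it may record abc-iut-s2-p11's surjective tie instead). PROVED. [claim: Mochizuki2012, status: disputed] -/
theorem cor312Of_of_statement_of_negLogQ_eq (D : InitialThetaData F K Fbar E l Pb)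
    {I : ThetaVolumeInput (fieldOfModuli E) K} (hI : ThetaData.IsVolumeInputOf D I)
    {T : Thm311.ThetaIndex} {S : Thm311.Situation T} {P : Cor312.Setting S}
    (hq : P.negLogQ = -absLogq D) (hΘ : P.negLogTheta ≤ ((I.negLogTheta : ℝ) : WithTop ℝ)) (h : P.Statement) :
    I.Cor312Of := by
  rw [ThetaVolumeInput.Cor312Of, negAbsLogQ_eq_neg_absLogq_of_isVolumeInputOf D hI, ← hq]
  obtain ⟨-, hle⟩ := h
  exact WithTop.coe_le_coe.mp (hle.trans hΘ)

end QIdentity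

end Summit.ABC.IUTFork.Cor312Prov

end
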